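import Mathlib
import Summits.KontsevichZagierPeriods.KontsevichZagierPeriods.Theorems.InverseLandauTateFamilyKernelRationalCertificate
import Summits.KontsevichZagierPeriods.KontsevichZagierPeriods.Theorems.InverseLandauTateFamilyKernelGapInstance

/-!
# `TateFamilyKernel` — the rule-(2) isotopy family is certified with ONE auxiliary variable (line `Sketch`, stub `stub_covInstance`)

Crux `TateFamilyKernel` (stmt-KontsevichZagierPeriods-9130, route `InverseLandau`), line `Sketch`.
The dimension-2 admissible Tate family `F = P/Q` with
`R = z₁ + z₁(1−z₁)z₂/2`, `Q = (1 − ϖz₁z₂)(1 − ϖ R z₂)`, `P = ∂₁R·(1 − ϖz₁z₂) − (1 − ϖ R z₂)`, i.e.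
`F = h(g z)·∂₁R − h(z)` for `h(y) = 1/(1 − ϖ y₁y₂)` and the polynomial self-map `g = (R, z₂)` of the
square, has identically vanishing open-square integrals (ONE change of variables, rule (2)) but is not
Griffiths-exact in the square variables. Its tame fibres at every real-algebraic `ϖ₀ ∈ (0,1)` are
nevertheless KZ relations by an `m = 1` rational Ayoub certificate along the polynomial isotopy
`Φ_s = (φ_s, w₁)`, `φ_s(w) = w₀ + s·w₀(1−w₀)w₁/2` (`Φ₀ = id`, `Φ₁ = g`): on the cube
`(w₀, w₁, s) ∈ [0,1]³` put `hΦ = 1/(1 − ϖ₀ φ_s w₁)`, `K = hΦ·∂_sφ_s`, `G = hΦ·∂₀φ_s`; then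
`∂₀K = ∂_sG`, `K` vanishes on the faces `w₀ ∈ {0,1}` and `G|_{s=1} − G|_{s=0} = F(w₀,w₁,ϖ₀)`, so
`F = relA₀(K) + relA_s(−G)` pointwise on `[0,1]³`. This is `rational_certificate` (p111536) with
`n = 2`, `m = 1`, `K = 2`, directions `(0, 2)` and the (denominator-cleared) rational data
`A₀/D = w₀(1−w₀)w₁ / (2 − ϖ(2w₀ + s w₀(1−w₀)w₁)w₁) = K`,
`A₁/D = −(2 + s(1−2w₀)w₁) / (2 − ϖ(2w₀ + s w₀(1−w₀)w₁)w₁) = −G`;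
the common denominator is `≥ 2(1 − ϖ₀) > 0` on the closed cube, so there is no wall on `(0,1)`.
References: Kontsevich–Zagier 2001 §1.2 rules (2), (3); Ayoub, EMS Newsl. 91 (2014) Def. 10.
-/

noncomputable section

open MeasureTheory Set MvPolynomial
open Literature.NumberTheory.Transcendental
open Literature.ModelTheory.ExponentialFields (IsSemialgebraic)

namespace Summit.KontsevichZagierPeriods.InverseLandau.TateFamilyKernel.Descent

namespace Cov

/-! ### Evaluation of the certificate polynomials (variables `X 0 = w₀, X 1 = w₁, X 2 = s, X 3 = ϖ`) -/

/-- Value of the numerator `A₀ = w₀(1−w₀)w₁` (`= 2∂_sφ_s`). [folklore] -/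
theorem evalA0 (v : Fin (2 + 1 + 1) → ℝ) :
    aeval v ((X 0 * (1 - X 0) * X 1) : MvPolynomial (Fin (2 + 1 + 1)) ℚ) = v 0 * (1 - v 0) * v 1 := by
  simp

/-- Value of the numerator `A₁ = −(2 + s(1−2w₀)w₁)` (`= −2∂₀φ_s`). [folklore] -/
theorem evalA1 (v : Fin (2 + 1 + 1) → ℝ) :
    aeval v ((-(C 2 + X 2 * (1 - C 2 * X 0) * X 1)) : MvPolynomial (Fin (2 + 1 + 1)) ℚ) =
      -(2 + v 2 * (1 - 2 * v 0) * v 1) := by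
  simp

/-- Value of the common denominator `D = 2 − ϖ(2w₀ + s w₀(1−w₀)w₁)w₁` (`= 2(1 − ϖ φ_s w₁)`). [folklore] -/
theorem evalD (v : Fin (2 + 1 + 1) → ℝ) :
    aeval v ((C 2 - X 3 * (C 2 * X 0 + X 2 * X 0 * (1 - X 0) * X 1) * X 1) : MvPolynomial (Fin (2 + 1 + 1)) ℚ) =
      2 - v 3 * (2 * v 0 + v 2 * v 0 * (1 - v 0) * v 1) * v 1 := by
  simp

/-- Value of the derivative numerator `∂₀A₀·D − A₀·∂₀D`. [folklore] -/
theorem evalN0 (v : Fin (2 + 1 + 1) → ℝ) :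
    aeval v (pderiv 0 ((X 0 * (1 - X 0) * X 1) : MvPolynomial (Fin (2 + 1 + 1)) ℚ) *
          (C 2 - X 3 * (C 2 * X 0 + X 2 * X 0 * (1 - X 0) * X 1) * X 1) -
        (X 0 * (1 - X 0) * X 1) * pderiv 0 (C 2 - X 3 * (C 2 * X 0 + X 2 * X 0 * (1 - X 0) * X 1) * X 1)) =
      ((1 - 2 * v 0) * v 1) * (2 - v 3 * (2 * v 0 + v 2 * v 0 * (1 - v 0) * v 1) * v 1) -
        (v 0 * (1 - v 0) * v 1) * (-(v 3 * (2 + v 2 * (1 - 2 * v 0) * v 1) * v 1)) := by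
  simp [Derivation.leibniz, smul_eq_mul, -mul_eq_mul_left_iff, -mul_eq_mul_right_iff]
  try ring

/-- Value of the derivative numerator `∂₂A₁·D − A₁·∂₂D`. [folklore] -/
theorem evalN1 (v : Fin (2 + 1 + 1) → ℝ) :
    aeval v (pderiv 2 ((-(C 2 + X 2 * (1 - C 2 * X 0) * X 1)) : MvPolynomial (Fin (2 + 1 + 1)) ℚ) *
          (C 2 - X 3 * (C 2 * X 0 + X 2 * X 0 * (1 - X 0) * X 1) * X 1) -
        (-(C 2 + X 2 * (1 - C 2 * X 0) * X 1)) *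
          pderiv 2 (C 2 - X 3 * (C 2 * X 0 + X 2 * X 0 * (1 - X 0) * X 1) * X 1)) =
      (-((1 - 2 * v 0) * v 1)) * (2 - v 3 * (2 * v 0 + v 2 * v 0 * (1 - v 0) * v 1) * v 1) -
        (-(2 + v 2 * (1 - 2 * v 0) * v 1)) * (-(v 3 * (v 0 * (1 - v 0) * v 1) * v 1)) := by
  simp [Derivation.leibniz, smul_eq_mul, -mul_eq_mul_left_iff, -mul_eq_mul_right_iff]
  try ring

/-- Value of the family numerator `P = ∂₁R·(1 − ϖz₁z₂) − (1 − ϖRz₂)`. [folklore] -/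
theorem evalP (v : Fin (2 + 1) → ℝ) :
    aeval v (((1 + (1 - C 2 * X 0) * X 1 * C (1 / 2 : ℚ)) * (1 - X 2 * X 0 * X 1) -
                (1 - X 2 * (X 0 + X 0 * (1 - X 0) * X 1 * C (1 / 2 : ℚ)) * X 1)) : MvPolynomial (Fin (2 + 1)) ℚ) =
      (1 + (1 - 2 * v 0) * v 1 * 2⁻¹) * (1 - v 2 * v 0 * v 1) -
        (1 - v 2 * (v 0 + v 0 * (1 - v 0) * v 1 * 2⁻¹) * v 1) := by
  simp

/-- Value of the family denominator `Q = (1 − ϖz₁z₂)(1 − ϖRz₂)`. [folklore] -/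
theorem evalQ (v : Fin (2 + 1) → ℝ) :
    aeval v (((1 - X 2 * X 0 * X 1) * (1 - X 2 * (X 0 + X 0 * (1 - X 0) * X 1 * C (1 / 2 : ℚ)) * X 1)) :
                MvPolynomial (Fin (2 + 1)) ℚ) =
      (1 - v 2 * v 0 * v 1) * (1 - v 2 * (v 0 + v 0 * (1 - v 0) * v 1 * 2⁻¹) * v 1) := by
  simp

/-! ### Positivity of the denominators on the closed cube for `0 < ϖ₀ < 1` -/

/-- `D = 2 − p(2a + c·a(1−a)b)b ≥ 2(1 − p) > 0` on the closed cube. [folklore] -/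
theorem D_pos {a b c p : ℝ} (h0 : 0 < p) (h1 : p < 1) (ha : 0 ≤ a ∧ a ≤ 1) (hb : 0 ≤ b ∧ b ≤ 1)
    (hc : 0 ≤ c ∧ c ≤ 1) : 0 < 2 - p * (2 * a + c * a * (1 - a) * b) * b := by
  have t0 : 0 ≤ a * (1 - a) := mul_nonneg ha.1 (sub_nonneg.2 ha.2)
  have cb0 : 0 ≤ c * b := mul_nonneg hc.1 hb.1
  have cb1 : c * b ≤ 1 := mul_le_one₀ hc.2 hb.1 hb.2
  have h4 : 0 ≤ c * b * (a * (1 - a)) := mul_nonneg cb0 t0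
  have h5 : c * b * (a * (1 - a)) ≤ a * (1 - a) := mul_le_of_le_one_left t0 cb1
  have hX0 : 0 ≤ 2 * a + c * a * (1 - a) * b := by nlinarith
  have hX2 : 2 * a + c * a * (1 - a) * b ≤ 2 := by nlinarith [sq_nonneg (1 - a)]
  have hXb : (2 * a + c * a * (1 - a) * b) * b ≤ 2 := by
    nlinarith [mul_le_of_le_one_right hX0 hb.2]
  nlinarith [mul_nonneg h0.le (sub_nonneg.2 hXb)]

/-- `1 − pab ≥ 1 − p > 0` on the closed square. [folklore] -/
theorem ab_pos {a b p : ℝ} (h0 : 0 < p) (h1 : p < 1) (ha : 0 ≤ a ∧ a ≤ 1) (hb : 0 ≤ b ∧ b ≤ 1) :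
    0 < 1 - p * a * b := by
  nlinarith [mul_nonneg h0.le (sub_nonneg.2 (mul_le_one₀ ha.2 hb.1 hb.2)), mul_nonneg ha.1 hb.1]

/-- `1 − pRb = D|_{c=1}/2 > 0` on the closed square. [folklore] -/
theorem R_pos {a b p : ℝ} (h0 : 0 < p) (h1 : p < 1) (ha : 0 ≤ a ∧ a ≤ 1) (hb : 0 ≤ b ∧ b ≤ 1) :
    0 < 1 - p * (a + a * (1 - a) * b * 2⁻¹) * b := by
  have h := D_pos (c := 1) h0 h1 ha hb ⟨zero_le_one, le_rfl⟩
  have e : 1 - p * (a + a * (1 - a) * b * 2⁻¹) * b = (2 - p * (2 * a + 1 * a * (1 - a) * b) * b) / 2 := by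
    ring
  rw [e]
  exact div_pos h two_pos

/-! ### The certificate identity (`a = w₀`, `b = w₁`, `c = s`, `p = ϖ₀`) -/

/-- The pointwise identity `F = relA₀(K) + relA_s(−G)` behind the certificate: the derivative parts
cancel (`∂₀K = ∂_sG`), the `w₀`-faces of `K` vanish, and the `s`-faces of `−G` give
`h(gz)∂₁R − h(z) = P/Q`. [cite: KontsevichZagier2001, §1.2 rules (2), (3)] -/
theorem cert (a b c p : ℝ) (hab : 1 - p * a * b ≠ 0) (hR : 1 - p * (a + a * (1 - a) * b * 2⁻¹) * b ≠ 0)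
    (hD1 : 2 - p * (2 * a + 1 * a * (1 - a) * b) * b ≠ 0)
    (hD0 : 2 - p * (2 * a + 0 * a * (1 - a) * b) * b ≠ 0) :
    ((1 + (1 - 2 * a) * b * 2⁻¹) * (1 - p * a * b) - (1 - p * (a + a * (1 - a) * b * 2⁻¹) * b)) /
        ((1 - p * a * b) * (1 - p * (a + a * (1 - a) * b * 2⁻¹) * b)) =
      ((1 - 2 * a) * b * (2 - p * (2 * a + c * a * (1 - a) * b) * b) -
            a * (1 - a) * b * (-(p * (2 + c * (1 - 2 * a) * b) * b))) /
          (2 - p * (2 * a + c * a * (1 - a) * b) * b) ^ 2 -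
        1 * (1 - 1) * b / (2 - p * (2 * 1 + c * 1 * (1 - 1) * b) * b) +
        0 * (1 - 0) * b / (2 - p * (2 * 0 + c * 0 * (1 - 0) * b) * b) +
      (((-((1 - 2 * a) * b)) * (2 - p * (2 * a + c * a * (1 - a) * b) * b) -
            (-(2 + c * (1 - 2 * a) * b)) * (-(p * (a * (1 - a) * b) * b))) /
          (2 - p * (2 * a + c * a * (1 - a) * b) * b) ^ 2 -
        (-(2 + 1 * (1 - 2 * a) * b)) / (2 - p * (2 * a + 1 * a * (1 - a) * b) * b) +
        (-(2 + 0 * (1 - 2 * a) * b)) / (2 - p * (2 * a + 0 * a * (1 - a) * b) * b)) := by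
  have e1 : ((1 - 2 * a) * b * (2 - p * (2 * a + c * a * (1 - a) * b) * b) -
            a * (1 - a) * b * (-(p * (2 + c * (1 - 2 * a) * b) * b))) /
          (2 - p * (2 * a + c * a * (1 - a) * b) * b) ^ 2 +
      ((-((1 - 2 * a) * b)) * (2 - p * (2 * a + c * a * (1 - a) * b) * b) -
            (-(2 + c * (1 - 2 * a) * b)) * (-(p * (a * (1 - a) * b) * b))) /
          (2 - p * (2 * a + c * a * (1 - a) * b) * b) ^ 2 = 0 := by
    rw [← add_div, div_eq_zero_iff]
    left
    ring
  have e4 : -(-(2 + 1 * (1 - 2 * a) * b)) / (2 - p * (2 * a + 1 * a * (1 - a) * b) * b) +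
      (-(2 + 0 * (1 - 2 * a) * b)) / (2 - p * (2 * a + 0 * a * (1 - a) * b) * b) =
      ((1 + (1 - 2 * a) * b * 2⁻¹) * (1 - p * a * b) - (1 - p * (a + a * (1 - a) * b * 2⁻¹) * b)) /
        ((1 - p * a * b) * (1 - p * (a + a * (1 - a) * b * 2⁻¹) * b)) := by
    rw [div_add_div _ _ hD1 hD0, div_eq_div_iff (mul_ne_zero hD1 hD0) (mul_ne_zero hab hR)]
    ring
  linear_combination e1 - e4

end Cov

open Cov in
/-- STUB `stub_covInstance` of line `Sketch` — **the rule-(2) isotopy family's tame fibres are relations.**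
For real-algebraic `ϖ₀` with `0 < ϖ₀ < 1`, every tame cube representation of the fibre at `ϖ₀` of
`F = h(g z)·∂₁R − h(z)`, `h(y) = 1/(1 − ϖy₁y₂)`, `g = (R, z₂)`, `R = z₁ + z₁(1−z₁)z₂/2`, on `[0,1]²`
lies in `KZ.relations`: the two-term `m = 1` rational `relA` certificate along the isotopy
`φ_s = w₀ + s·w₀(1−w₀)w₁/2` (`Cov.cert`) fed to `rational_certificate`.
[cite: KontsevichZagier2001, §1.2 rules (2), (3)] -/
theorem stub_covInstance :
    ∀ (ϖ₀ : ℝ), IsAlgebraic ℚ ϖ₀ → 0 < ϖ₀ → ϖ₀ < 1 →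
      ∀ Φ : KZ.IntegralRep 2, Φ.IsTameCube →
        (∀ z ∈ KZ.cube 2, Φ.integrand z =
          aeval (Fin.snoc z ϖ₀ : Fin (2 + 1) → ℝ)
              (((1 + (1 - C 2 * X 0) * X 1 * C (1 / 2 : ℚ)) * (1 - X 2 * X 0 * X 1) -
                (1 - X 2 * (X 0 + X 0 * (1 - X 0) * X 1 * C (1 / 2 : ℚ)) * X 1)) : MvPolynomial (Fin (2 + 1)) ℚ) /
            aeval (Fin.snoc z ϖ₀ : Fin (2 + 1) → ℝ)
              (((1 - X 2 * X 0 * X 1) * (1 - X 2 * (X 0 + X 0 * (1 - X 0) * X 1 * C (1 / 2 : ℚ)) * X 1)) :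
                MvPolynomial (Fin (2 + 1)) ℚ)) →
        KZ.of Φ ∈ KZ.relations := by
  intro ϖ₀ halg h0 h1 Φ hΦ hΦi
  refine rational_certificate (n := 2) (m := 1) (K := 2) _ _
    ![(X 0 * (1 - X 0) * X 1), (-(C 2 + X 2 * (1 - C 2 * X 0) * X 1))]
    (fun _ => C 2 - X 3 * (C 2 * X 0 + X 2 * X 0 * (1 - X 0) * X 1) * X 1)
    ![0, 2] halg (fun z hz => ?_) (fun k w hw => ?_) (fun w hw => ?_) Φ hΦ hΦi
  · -- `Q(z, ϖ₀) ≠ 0` on the closed square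
    rw [evalQ, Gap.snoc3_0, Gap.snoc3_1, Gap.snoc3_2]
    exact mul_ne_zero (ab_pos h0 h1 (KZ.mem_cube.1 hz 0) (KZ.mem_cube.1 hz 1)).ne'
      (R_pos h0 h1 (KZ.mem_cube.1 hz 0) (KZ.mem_cube.1 hz 1)).ne'
  · -- the common denominator does not vanish on the closed cube
    show aeval (Fin.snoc w ϖ₀ : Fin (2 + 1 + 1) → ℝ)
      ((C 2 - X 3 * (C 2 * X 0 + X 2 * X 0 * (1 - X 0) * X 1) * X 1) : MvPolynomial (Fin (2 + 1 + 1)) ℚ) ≠ 0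
    rw [evalD, Gap.snoc4_0, Gap.snoc4_1, Gap.snoc4_2, Gap.snoc4_3]
    exact (D_pos h0 h1 (KZ.mem_cube.1 hw 0) (KZ.mem_cube.1 hw 1) (KZ.mem_cube.1 hw 2)).ne'
  · -- the pointwise identity on `[0,1]³`
    have ha := KZ.mem_cube.1 hw 0
    have hb := KZ.mem_cube.1 hw 1
    have hc := KZ.mem_cube.1 hw 2
    have hD1 := (D_pos (c := 1) h0 h1 ha hb ⟨zero_le_one, le_rfl⟩).ne'
    have hD0 := (D_pos (c := 0) h0 h1 ha hb ⟨le_rfl, zero_le_one⟩).ne'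
    have hab := (ab_pos h0 h1 ha hb).ne'
    have hR := (R_pos h0 h1 ha hb).ne'
    have hc2 : (Fin.castSucc (2 : Fin (2 + 1)) : Fin (2 + 1 + 1)) = 2 := rfl
    have hca0 : (Fin.castAdd 1 (0 : Fin 2) : Fin (2 + 1)) = 0 := rfl
    have hca1 : (Fin.castAdd 1 (1 : Fin 2) : Fin (2 + 1)) = 1 := rfl
    simp only [Fin.sum_univ_two, Matrix.cons_val_zero, Matrix.cons_val_one, Fin.castSucc_zero, hc2]
    simp only [map_pow, evalN0, evalN1, evalA0, evalA1, evalD, evalP, evalQ]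
    simp only [Gap.snoc4_0, Gap.snoc4_1, Gap.snoc4_2, Gap.snoc4_3, Gap.snoc3_0, Gap.snoc3_1,
      Gap.snoc3_2, hca0, hca1]
    have hu00 : Function.update w 0 (1 : ℝ) 0 = 1 := Function.update_self ..
    have hu01 : Function.update w 0 (1 : ℝ) 1 = w 1 := Function.update_of_ne (by decide) ..
    have hu02 : Function.update w 0 (1 : ℝ) 2 = w 2 := Function.update_of_ne (by decide) ..
    have hz00 : Function.update w 0 (0 : ℝ) 0 = 0 := Function.update_self ..
    have hz01 : Function.update w 0 (0 : ℝ) 1 = w 1 := Function.update_of_ne (by decide) ..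
    have hz02 : Function.update w 0 (0 : ℝ) 2 = w 2 := Function.update_of_ne (by decide) ..
    have hu20 : Function.update w 2 (1 : ℝ) 0 = w 0 := Function.update_of_ne (by decide) ..
    have hu21 : Function.update w 2 (1 : ℝ) 1 = w 1 := Function.update_of_ne (by decide) ..
    have hu22 : Function.update w 2 (1 : ℝ) 2 = 1 := Function.update_self ..
    have hz20 : Function.update w 2 (0 : ℝ) 0 = w 0 := Function.update_of_ne (by decide) ..
    have hz21 : Function.update w 2 (0 : ℝ) 1 = w 1 := Function.update_of_ne (by decide) ..
    have hz22 : Function.update w 2 (0 : ℝ) 2 = 0 := Function.update_self ..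
    simp only [hu00, hu01, hu02, hz00, hz01, hz02, hu20, hu21, hu22, hz20, hz21, hz22]
    linear_combination cert (w 0) (w 1) (w 2) ϖ₀ hab hR hD1 hD0

end Summit.KontsevichZagierPeriods.InverseLandau.TateFamilyKernel.Descent
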